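import Summits.CriticalPhenomena.PercolationContinuityZ3.Theorems.FK.MagnetizationPhaseCoexistence
import HarnessLib

/-!
# ELLIS' CRITERION AT ZERO FIELD FOR THE FINITE-VOLUME GIBBS STATES OF `ℤ^d` WITH ARBITRARY BOUNDARY CONDITION:
# `M_N/|Λ_N|` CONVERGES EXPONENTIALLY TO A CONSTANT IFF `m*(β) = 0` IFF `ψ(β,·)` IS DIFFERENTIABLE AT `0` IFF `β ≤ β_c`
# (Ellis 2006, Thm. IV.5.5 and Thm. V.6.1 (c)–(d))

Claimed R42 (8)(c) in the cell INBOX at 2026-08-29T07:49:00Z by fkp-10a gen 359 (NEW CLAIM #2 of the gen), addressed to coordinator fk-4 gen 294 (seated 06:59Z 2026-08-29 by l.8791; R172 l.8793 = row FO-10a-g359 in force; ruling R173 requested); lineage row FO-10a-g359c (self-suggested), package g359-criterion, label LD-F.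
Helper file of the `fk-continuity` build cell (bschramm lane; `--supports stmt-CriticalPhenomena-4575`); builds on
p205010 (kernel theorem, internal audit signed; external expert review pending). No definitions, no named facts, no
sorries; standard axioms. UNCONDITIONAL (nearest-neighbour Ising model on `ℤ^d`, boxes `Λ_N = {−N,…,N}^d`, zero field,
EVERY boundary condition; `μ_N = μ^{bc}_{Λ_N;β,0}`, `M_N = Σ_{x∈Λ_N} σ_x`). "Exponential convergence of `M_N/|Λ_N|` to `m₀`"
is Ellis' (2.31): for every `ε > 0` there is `c > 0` with `μ_N{ε ≤ |M_N/|Λ_N| − m₀|} ≤ e^{−c|Λ_N|}` eventually.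

* **`not_exp_convergence_of_spontaneousMagnetization_pos`** — if `m*(β) > 0` then for NO constant `m₀` and NO boundary
  condition does `M_N/|Λ_N|` converge exponentially to `m₀` (one of the phases `±m*` is `ε`-far from `m₀` and is
  reached at surface-order cost, `MagnetizationPhaseCoexistence`; Ellis Thm. V.6.1 (d): "exponential convergence
  fails"); `not_exp_convergence_of_criticalBeta_lt` (`d ≥ 2`, `β > β_c`);
* **`exp_convergence_zero_field_iff_spontaneousMagnetization_eq_zero`** — ELLIS THM. IV.5.5 AT `h = 0`: `M_N/|Λ_N|`
  converges exponentially to some constant under a given boundary condition iff `m*(β) = 0` (and then to `0`, under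
  every boundary condition, `MagnetizationExponentialLLN`);
  **`exp_convergence_zero_field_iff_differentiableAt_pressure`** — iff `ψ(β,·)` is differentiable at `h = 0` (Ellis'
  formulation); **`exp_convergence_zero_field_iff_hasUniqueGibbsMeasure`** — iff `|𝒢(β,0)| = 1` (THE LEVEL-1 AND
  LEVEL-3 PHASE TRANSITIONS COINCIDE); **`exp_convergence_zero_field_iff_le_criticalBeta`** — iff `β ≤ β_c(d)` (`d ≥ 2`;
  the exponential law of large numbers holds exactly up to and including the critical temperature).

## References

* R. S. Ellis, *Entropy, Large Deviations, and Statistical Mechanics*, Springer (1985/2006), (2.31), Thm. II.6.3,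
  §IV.5 Thm. IV.5.5, §V.6 Thm. V.6.1 (c)–(e), Note 13 to Ch. IV. [Ellis2006]
* S. Friedli, Y. Velenik, *Statistical Mechanics of Lattice Systems*, CUP (2017), Thm. 3.25, Prop. 3.29, Thm. 3.34.
  [FriedliVelenik2017]
* O. E. Lanford, *Entropy and equilibrium states in classical statistical mechanics*, LNP 20, Springer (1973),
  1–113. [Lanford1973]
-/

noncomputable section

namespace Summit.CriticalPhenomena.PercolationContinuityZ3.Theorems.FK

namespace IsingLargeDeviations

open MeasureTheory ProbabilityTheory Filter Topology Finset Set
open Literature.Probability.LatticeModels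

variable {d : ℕ}


/-- **IF `m*(β) > 0` THEN `M_N/|Λ_N|` DOES NOT CONVERGE EXPONENTIALLY TO ANY CONSTANT, UNDER ANY BOUNDARY CONDITION**
(`d ≥ 1`, `β ≥ 0`): for every `m₀` and every `bc`, it is false that for every `ε > 0` there is `c > 0` with
`μ^{bc}_{Λ_N;β,0}{ε ≤ |M_N/|Λ_N| − m₀|} ≤ e^{−c|Λ_N|}` eventually — one of the two phases `±m*` is `ε`-far from `m₀`
and is reached at surface-order cost. [cite: Ellis2006, Thm. V.6.1 (d) ("exponential convergence fails") and Thm. IV.5.5] -/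
theorem not_exp_convergence_of_spontaneousMagnetization_pos (hd : 1 ≤ d) {β : ℝ} (hβ : 0 ≤ β)
    (hm : 0 < spontaneousMagnetization d β) (m₀ : ℝ) (bc : BoundaryCondition (Site d)) :
    ¬ ∀ ε : ℝ, 0 < ε → ∃ c : ℝ, 0 < c ∧ ∀ᶠ N : ℕ in atTop,
      (isingMeasure (zdGraph d) (box d N) β 0 bc).real
          {σ | ε ≤ |(∑ x ∈ box d N, spinAt x σ) / #(box d N) - m₀|} ≤ Real.exp (-(c * #(box d N))) := by
  intro hconv
  set m := spontaneousMagnetization d β with hmdef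
  have hm1 : m ≤ 1 := spontaneousMagnetization_le_one_holds (d := d) hβ
  by_cases hcase : m₀ < m
  · -- the `+` phase is far from `m₀`
    set ε := (m - m₀) / 2 with hε
    have hεpos : 0 < ε := by rw [hε]; linarith
    obtain ⟨c, hc, hev⟩ := hconv ε hεpos
    have hκ : 0 < ε / (1 - m + ε) := div_pos hεpos (by linarith)
    have hlt := eventually_exp_neg_mul_card_lt hd β hκ hc
    obtain ⟨N, hN1, hN2⟩ := (hev.and hlt).exists
    have hV : (0 : ℝ) < #(box d N) := by exact_mod_cast (box_nonempty d N).card_pos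
    have hsub : {σ : SpinConfig (Site d) | (m - ε) * #(box d N) ≤ ∑ x ∈ box d N, spinAt x σ} ⊆
        {σ | ε ≤ |(∑ x ∈ box d N, spinAt x σ) / #(box d N) - m₀|} := by
      intro σ hσ
      simp only [mem_setOf_eq] at hσ ⊢
      have h1 : m - ε ≤ (∑ x ∈ box d N, spinAt x σ) / #(box d N) := by rwa [le_div_iff₀ hV]
      have h2 : ε ≤ (∑ x ∈ box d N, spinAt x σ) / #(box d N) - m₀ := by rw [hε] at h1 ⊢; linarith
      exact h2.trans (le_abs_self _)
    have h3 := exp_mul_div_le_measureReal_ge (d := d) hβ hεpos bc N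
    have h4 := (measureReal_mono hsub).trans hN1
    linarith
  · -- the `−` phase is far from `m₀`
    have hcase : m ≤ m₀ := not_lt.1 hcase
    set ε := (m₀ + m) / 2 with hε
    have hεpos : 0 < ε := by rw [hε]; linarith
    obtain ⟨c, hc, hev⟩ := hconv ε hεpos
    have hκ : 0 < ε / (1 - m + ε) := div_pos hεpos (by linarith)
    have hlt := eventually_exp_neg_mul_card_lt hd β hκ hc
    obtain ⟨N, hN1, hN2⟩ := (hev.and hlt).exists
    have hV : (0 : ℝ) < #(box d N) := by exact_mod_cast (box_nonempty d N).card_pos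
    have hsub : {σ : SpinConfig (Site d) | ∑ x ∈ box d N, spinAt x σ ≤ (-m + ε) * #(box d N)} ⊆
        {σ | ε ≤ |(∑ x ∈ box d N, spinAt x σ) / #(box d N) - m₀|} := by
      intro σ hσ
      simp only [mem_setOf_eq] at hσ ⊢
      have h1 : (∑ x ∈ box d N, spinAt x σ) / #(box d N) ≤ -m + ε := by rwa [div_le_iff₀ hV]
      have h2 : ε ≤ -((∑ x ∈ box d N, spinAt x σ) / #(box d N) - m₀) := by rw [hε] at h1 ⊢; linarith
      exact h2.trans (neg_le_abs _)
    have h3 := exp_mul_div_le_measureReal_le (d := d) hβ hεpos bc N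
    have h4 := (measureReal_mono hsub).trans hN1
    linarith

/-- **For `d ≥ 2` and `β > β_c(d)`: no exponential convergence of `M_N/|Λ_N|` at `h = 0`, under any boundary
condition.** [cite: Ellis2006, Thm. V.6.1 (d); FriedliVelenik2017, Thm. 3.25] -/
theorem not_exp_convergence_of_criticalBeta_lt (hd : 2 ≤ d) {β : ℝ} (hβc : criticalBeta d < β) (m₀ : ℝ)
    (bc : BoundaryCondition (Site d)) :
    ¬ ∀ ε : ℝ, 0 < ε → ∃ c : ℝ, 0 < c ∧ ∀ᶠ N : ℕ in atTop,
      (isingMeasure (zdGraph d) (box d N) β 0 bc).real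
          {σ | ε ≤ |(∑ x ∈ box d N, spinAt x σ) / #(box d N) - m₀|} ≤ Real.exp (-(c * #(box d N))) :=
  not_exp_convergence_of_spontaneousMagnetization_pos (by omega) ((criticalBeta_nonneg d).trans hβc.le)
    (spontaneousMagnetization_pos_of_criticalBeta_lt_holds hd hβc) m₀ bc

/-- **ELLIS THM. IV.5.5 AT ZERO FIELD, FINITE-VOLUME GIBBS STATES OF `ℤ^d` WITH ARBITRARY BOUNDARY CONDITION** (`d ≥ 1`,
`β > 0`): `M_N/|Λ_N|` converges exponentially to some constant under some boundary condition — equivalently to `0`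
under every boundary condition, with constants uniform in the boundary condition — IFF `m*(β) = 0`.
[cite: Ellis2006, Thm. IV.5.5 and Thm. V.6.1 (c)–(d)] -/
theorem exp_convergence_zero_field_iff_spontaneousMagnetization_eq_zero (hd : 1 ≤ d) {β : ℝ} (hβ : 0 < β)
    (bc : BoundaryCondition (Site d)) :
    (∃ m₀ : ℝ, ∀ ε : ℝ, 0 < ε → ∃ c : ℝ, 0 < c ∧ ∀ᶠ N : ℕ in atTop,
      (isingMeasure (zdGraph d) (box d N) β 0 bc).real
          {σ | ε ≤ |(∑ x ∈ box d N, spinAt x σ) / #(box d N) - m₀|} ≤ Real.exp (-(c * #(box d N)))) ↔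
      spontaneousMagnetization d β = 0 := by
  constructor
  · rintro ⟨m₀, hm₀⟩
    by_contra hne
    have hpos : 0 < spontaneousMagnetization d β :=
      lt_of_le_of_ne (spontaneousMagnetization_nonneg_holds (d := d) hβ.le) (Ne.symm hne)
    exact not_exp_convergence_of_spontaneousMagnetization_pos hd hβ.le hpos m₀ bc hm₀
  · intro hm
    refine ⟨0, fun ε hε => ?_⟩
    obtain ⟨c, hc, h⟩ := exp_concentration_zero_field_of_spontaneousMagnetization_eq_zero hd hβ hm hε
    exact ⟨c, hc, by simpa only [sub_zero] using h bc⟩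

/-- **… IFF `ψ(β,·)` IS DIFFERENTIABLE AT `h = 0`** (Ellis' formulation of Thm. IV.5.5: `S_Λ/|Λ| →exp m` iff
`∂ψ/∂h` exists). [cite: Ellis2006, Thm. IV.5.5; FriedliVelenik2017, Thm. 3.34] -/
theorem exp_convergence_zero_field_iff_differentiableAt_pressure (hd : 1 ≤ d) {β : ℝ} (hβ : 0 < β)
    (bc : BoundaryCondition (Site d)) :
    (∃ m₀ : ℝ, ∀ ε : ℝ, 0 < ε → ∃ c : ℝ, 0 < c ∧ ∀ᶠ N : ℕ in atTop,
      (isingMeasure (zdGraph d) (box d N) β 0 bc).real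
          {σ | ε ≤ |(∑ x ∈ box d N, spinAt x σ) / #(box d N) - m₀|} ≤ Real.exp (-(c * #(box d N)))) ↔
      DifferentiableAt ℝ (fun t => pressure d β t) 0 := by
  rw [exp_convergence_zero_field_iff_spontaneousMagnetization_eq_zero hd hβ bc,
    IsingSusceptibility.differentiableAt_pressure_zero_iff hd hβ]

/-- **LEVEL-1 AND LEVEL-3 PHASE TRANSITIONS COINCIDE AT ZERO FIELD**: for `d ≥ 1`, `β > 0`, `M_N/|Λ_N|` converges
exponentially to a constant under the finite-volume Gibbs states (any fixed boundary condition) iff the infinite-volume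
Gibbs measure at `(β, 0)` is unique (`|𝒢(β,0)| = 1`; via `hasUniqueGibbsMeasure_iff_differentiableAt_pressure`).
[cite: Ellis2006, Thm. IV.5.5, Thm. V.6.1 (b)–(d) and §IV.6 (level-1 vs level-3 phase transitions); FriedliVelenik2017, Thm. 3.34] -/
theorem exp_convergence_zero_field_iff_hasUniqueGibbsMeasure (hd : 1 ≤ d) {β : ℝ} (hβ : 0 < β)
    (bc : BoundaryCondition (Site d)) :
    (∃ m₀ : ℝ, ∀ ε : ℝ, 0 < ε → ∃ c : ℝ, 0 < c ∧ ∀ᶠ N : ℕ in atTop,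
      (isingMeasure (zdGraph d) (box d N) β 0 bc).real
          {σ | ε ≤ |(∑ x ∈ box d N, spinAt x σ) / #(box d N) - m₀|} ≤ Real.exp (-(c * #(box d N)))) ↔
      HasUniqueGibbsMeasure (isingSpecification (zdGraph d) β 0) := by
  rw [exp_convergence_zero_field_iff_differentiableAt_pressure hd hβ bc,
    IsingSusceptibility.hasUniqueGibbsMeasure_iff_differentiableAt_pressure hd hβ 0]

/-- **… IFF `β ≤ β_c(d)`** (`d ≥ 2`): the exponential law of large numbers for the magnetisation density at zero field
holds exactly up to and including the critical temperature. [cite: Ellis2006, Thm. IV.5.5 and Thm. V.6.1; FriedliVelenik2017, Thm. 3.25] -/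
theorem exp_convergence_zero_field_iff_le_criticalBeta (hd : 2 ≤ d) {β : ℝ} (hβ : 0 < β)
    (bc : BoundaryCondition (Site d)) :
    (∃ m₀ : ℝ, ∀ ε : ℝ, 0 < ε → ∃ c : ℝ, 0 < c ∧ ∀ᶠ N : ℕ in atTop,
      (isingMeasure (zdGraph d) (box d N) β 0 bc).real
          {σ | ε ≤ |(∑ x ∈ box d N, spinAt x σ) / #(box d N) - m₀|} ≤ Real.exp (-(c * #(box d N)))) ↔
      β ≤ criticalBeta d := by
  rw [exp_convergence_zero_field_iff_spontaneousMagnetization_eq_zero (by omega) hβ bc]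
  constructor
  · intro hm
    by_contra hlt
    exact (spontaneousMagnetization_pos_of_criticalBeta_lt_holds hd (not_le.1 hlt)).ne' hm
  · intro hβc
    exact IsingSusceptibility.spontaneousMagnetization_eq_zero_of_hasUniqueGibbsMeasure (d := d) hβ.le
      ((IsingSusceptibility.hasUniqueGibbsMeasure_zero_field_iff hd hβ).2 hβc)

end IsingLargeDeviations

end Summit.CriticalPhenomena.PercolationContinuityZ3.Theorems.FK
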